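import Mathlib.RingTheory.PowerSeries.Order
import Literature.NumberTheory.IwasawaTheory.PSCyclotomicLFunction
import HarnessLib

/-!
# The finite-slope (Pottharst–Benois) cyclotomic Iwasawa module of the untwist and its
# characteristic element — `PSFiniteSlopeSelmerData W η α`: DEFINITIONS ONLY (a hypothesis structure
# in the currency of `PSCyclotomicLFunction`, `Prop`-valued predicates, proved unfolding API; no named
# fact, no existence claim, no leading-term formula)

Definition item `defn-PSFiniteSlopeSelmer` (trunk `Literature/NumberTheory/IwasawaTheory`; wanted by route
`CyclotomicUntwist` of `BirchSwinnertonDyer`, crux `PSRankOneLowerHalfAtThree` = stmt-BirchSwinnertonDyer-21580,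
definition request D3; D1 = `IsPSCyclotomicLFunctionOf` (this directory), D2 = `WeierstrassCurve.PSLineHeightData`
(`Literature/NumberTheory/EllipticCurves/PSLineHeight.lean`) are landed).

## The printed object (what the datum is INTENDED to be)

Coefficients: a finite `E/ℚ_p`; `Γ = Gal(ℚ(μ_{p^∞})/ℚ)`-part `Γ ≅ 1 + pℤ_p` (`p` odd), `Λ = 𝓞_E[[Γ]]`, and the large
algebra `𝓗 = {f ∈ E[[X]] : f converges on the open unit disc}` = `lim_n Γ(W_n, 𝓞)` (Benois 2014 §1.6, held text
`paper:arxiv-1404.7386` p0010–p0011: *"A coadmissible 𝓗-module M is the inverse limit of a system (M_n) where each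
M_n is a finitely generated 𝓗_n-module and the natural maps M_n ⊗ 𝓗_{n−1} → M_{n−1} are isomorphisms"*;
Prop. 3 = [Pottharst 2012, Prop. 1.1]: a coadmissible torsion module is `∏_i 𝓗/𝔭_i^{n_i}`; §2.4 Remark 2: *"from
Lazard's theory it follows that there exists a unique up to multiplication by a unit of Λ[1/p] element f ∈ 𝓗 such
that div(f) = ∑ n_i 𝔭_i. The characteristic ideal char_𝓗 M is defined to be the principal ideal generated by f."*).
Pottharst 2013 (held text `paper:doi-10-2140-ant-2013-7-1571`) supplies the local condition: §3B p. 1603 *"Given a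
sub-(φ,Γ)-module F⁺ ⊆ D that is a module-direct summand … the (strict) ordinary local condition given by the morphism
RΓ_str(G, D) = RΓ(G, F⁺) → RΓ(G, D)"*, Example 3.5 *"When A° = ℚ_p, being nearly ordinary with a complete flag means
being (split) trianguline"*, Example 3.12 p. 1606 *"V_f is ordinary in our sense … provided f has finite slope: the
matrix of φ on D_pst(V_f) is nonscalar … equivalent to there being some twist f ⊗ ε by a Dirichlet character ε that
has an associated U_p-eigenform with nonzero U_p-eigenvalue"* (p. 1572: *"local Weil–Deligne representation at p that
is nonsupercuspidal and of nonscalar Frobenius"* — the PRINCIPAL-SERIES rows), the Selmer complexes of §1E in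
situation (4)–(5) (coadmissible cohomology over `A_∞`, §1C–§1D), §3D p. 1607 *"Using the strict ordinary local
condition given by the F_v^{α_v} at places v ∈ S dividing p and the unramified local condition at places v ∈ S not
dividing p, we build … the strict ordinary Selmer complex"*; and p. 1573: *"Our theory is incomplete in that we have
direct access to no integral information, having chosen to exchange it for major simplifications … when working only
up-to-isogeny."*  Benois 2014 §0.4 "Main Conjecture" (p0004): for `D` regular, *"i) H^i_Iw(V,D) = 0 for i ≠ 2.
ii) H²_Iw(V,D) is a coadmissible torsion 𝓗-module and char_𝓗(H²_Iw(V,D)) = (f_D) where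
L_p(M,D,s) = f_D(χ(γ₀)^s − 1)"*, Remark 1: *"Since 𝓗^* = Λ[1/p]^*, our Main Conjecture determines f_D up to
multiplication by a unit in Λ[1/p]"*, Remark 4 (Kato: `f_α ∈ char_𝓗 H²_Iw(V, D_α)` for `(p,N) = 1`,
[Pottharst 2012, Thm. 5.4]); §4.1 Definition *"We will call H¹(V,D) the extended Selmer group associated to D"*
(Prop. 11: `0 → H⁰(𝐌₁) → H¹(V,D) → H¹_f(ℚ,V) → 0`); §4.2 Definition of the height `⟨x,y⟩_{V,D} = β(x) ∪ y`
(Bockstein `β`), Prop. 12 (non-degenerate height + weak Leopoldt ⇒ `H¹_Iw(V,D) = 0`, `H²_Iw(V,D)` torsion).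

INTENDED INSTANCE.  `p = 3`; `(W, η, α)` the untwist datum of D1: `W/ℚ` with wild additive potentially good
(supersingular) reduction at `3` of principal-series type, `η` primitive mod `9` matching the inertia character,
`g = f_W ⊗ η̄` the newform of level `9M` with `U₃ g = α g`, `v₃(α) = ½`; `V = V₃(g) = V₃(W) ⊗ η̄` (with
coefficients `E ∋ α, ζ₃`), which is of finite slope at `3`, hence trianguline (Example 3.12): `D_α ⊂ D†_rig(V|_{G_{ℚ₃}})`
the rank-one `(φ,Γ)`-submodule of the `α`-triangulation (the tree's vocabulary for this is
`Literature.NumberTheory.GaloisRepresentations.Trianguline`: `PhiGammaModuleData`, `FramedGaloisRep.IsTriangulineWith`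
— a parameter `δ` with `δ₁(3) = α`; NOT rebuilt here); `H²_Iw(V, D_α)` = the degree-2 cohomology of the strict
ordinary (`F⁺ = D_α`) cyclotomic Iwasawa Selmer complex over `𝓗` (Pottharst §1E/§3D; Benois (0.4)), a coadmissible
`𝓗`-module, torsion under Prop. 12's hypotheses; `char := ` a generator `f` of `char_𝓗 H²_Iw(V, D_α)`, read as a
distribution on `Γ` through `𝓗 ⊂` distributions (`f(χ(γ₀)^s − 1) = ∫_Γ ⟨u⟩^s df`).

## What is typed (faithfulness sheet)

NONE of `𝓗`-modules, coadmissibility, `(φ,Γ)`-cohomology or Selmer complexes exists in Mathlib, so — exactly as D2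
(`PSLineHeightData`: "hypothesis structure … the zero family is a datum … consumers quantify over the datum") — the
notion is a HYPOTHESIS STRUCTURE whose fields are what the consumer statements GZ₃ ∧ IMC₃ ∧ READ of crux K1 need,
written in D1's CURRENCY (ball values `(n : ℕ) → ZMod (3 ^ n) → ℂ_[3]` on `Γ = 1 + 3ℤ₃`, `IsGammaDistribution`,
`HasGrowthOrder`, `gammaCharValue`, `gammaAmiceTransform`):

* (a) `charElt` — ONE CHOSEN GENERATOR of `char_𝓗 H²_Iw(V, D_α)` as an additive system of ball values of growth
  order `≤ ½ = v₃(α)`.  NORMALISATION CAVEAT (flagged, part of the hypothesis): a general element of `𝓗` need not be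
  tempered; a generator of order `≤ ½` exists under IMC₃ (then `f = unit · 𝓛`, `𝓛` of order `½` by D1) and, for
  crystalline `V`, by Perrin-Riou's `𝐋_Iw(D,V) ⊂ 𝓗` with `i_{V,D}(𝐋_Iw) ⊗ ℚ_p = char_𝓗 H²_Iw` (Benois §0.4
  Remark 3, [Pottharst 2012]); order `< 1` is what makes the generator DETERMINED by its values at the finite-order
  characters of `Γ` (Bellaïche Thm. 6.2.13, D1) and makes D1's `gammaMahlerCoeff`/`gammaAmiceTransform` honest limits.
* (b) THE AMBIGUITY, explicit: `f` is determined only up to `𝓗^× = Λ[1/p]^× = p^ℤ · Λ^×` (Benois §0.4 Remark 1;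
  for `E/ℚ_p` ramified read `ϖ_E^ℤ · Λ^×` — TODO(general form): the tree fixes `3^ℤ`) and carries NO integral
  information (Pottharst p. 1573).  Typed twice: the unit classes `IsIwasawaUnit` (`Λ_𝓞^×`: additive, values of norm
  `≤ 1`, total mass of norm `1`) and `IsIwasawaUnitUpToPPower` (`p^ℤ · Λ_𝓞^×`), the convolution `gammaConv` (the
  product of `Λ ⊂ 𝓗`, Bellaïche §6.3.5: `Λ = lim ℤ_p[Γ/Γ^{pⁿ}]`, level-`n` product = group-ring product), AND a
  VISIBLE integer field `pPowerShift : ℤ` — the exponent `e` by which a consumer DECLARES the chosen generator to sit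
  above its (conjectural, integral, Greenberg-type — Benois §0.4 Remark 2) normalisation, with the normalisation
  PREDICATE `IsNormalisedFor` (`charElt = 3^e · (v ⋆ 𝓛)`, `v ∈ Λ_𝓞^×`) making the declaration checkable against
  IMC₃; nothing in the structure constrains `e` (never hidden, never asserted).
* (c) THE INTERFACE AT THE TRIVIAL CHARACTER: `orderAtOne` = order of vanishing of the Amice transform of `charElt`
  at `T = 0` (`T = 0 ↔ 𝟙`, D1 `gammaAmiceTransform`), `leadingCoeffAtOne` = its first non-zero coefficient (both
  DEFINED from `charElt`, not free slots), and a visible slot `selmerRank : ℕ` for `dim_E` of the extended Selmer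
  group `H¹(V, D_α)` (Benois §4.1; the "`𝓗`-corank of `H¹` on the `ψ`-line" of the request); the control
  inequality `selmerRank ≤ orderAtOne` and the exact-order statement are `Prop`-valued predicates
  (`HasControlInequality`, `HasExactOrderAtOne`), NOT fields; the Perrin-Riou/Bloch–Kato leading-term formula
  (`ord₃ leadingCoeffAtOne` vs `#Ш · ∏ c_ℓ · Reg_ψ / #tors²`, Perrin-Riou 1993; Benois §4.2) is the route's READ
  crux and is deliberately ABSENT (human ruling: unproven statements live in Theses, not Literature).
* IMC₃ shapes for the consumer: `IsUnitMultipleOf D 𝓛` (`∃ u ∈ 3^ℤ·Λ_𝓞^×, charElt = u ⋆ 𝓛`, Benois §0.4 (ii)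
  read through Remark 1) and the character-value form `IsUnitMultipleOfAtCharacters` (`char(ξ) = u(ξ) · 𝓛(ξ)` for
  every Dirichlet character of `3`-power conductor) named in the request; `𝓛` is any ball system — the consumer
  supplies `IsPSCyclotomicLFunctionOf W η α 𝓛` (D1).
* Vacuity flag: `PSFiniteSlopeSelmerData.zero` (the zero system with `e = 0`, `selmerRank = 0`) inhabits the type,
  so `PSFiniteSlopeSelmerData W η α` is NOT an existence statement and consumers quantify over the datum.
  WEAKER container than print (values in `ℂ₃`, not `E`); `(W, η, α)` are phantom parameters tagging the intended
  instance exactly as in D1.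

Honest framing: bookkeeping vocabulary for a conditional BSD route; nothing here is evidence for BSD or for any
main conjecture, and the structure can be inhabited by junk (by design, documented).

## References

* J. Pottharst, *Analytic families of finite-slope Selmer groups*, Algebra & Number Theory 7 (2013) 1571–1612,
  §1C–§1E, §3B (p. 1603), Examples 3.5, 3.12, §3D (p. 1607), p. 1573. [Pottharst2013]
* D. Benois, *Selmer complexes and p-adic Hodge theory*, arXiv:1404.7386 (2014), §0.4 (Main Conjecture, Remarks
  1–4), §1.6 (𝓗, coadmissible modules, Prop. 3), §2.4 (Remark 2: characteristic ideal), §4.1 (extended Selmer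
  group, Prop. 11), §4.2 (height pairing, Prop. 12). [Benois2014]
* J. Pottharst, *Cyclotomic Iwasawa theory of motives*, preprint (2012) — WANTED (acq-13581); used only through the
  quotations of it printed in [Benois2014] §0.4 and §1.6.
* J. Bellaïche, *The Eigenbook* (2021), §6.3.5 (the Iwasawa algebra `Λ = lim ℤ_p[ℤ_p^×/(1 + pⁿℤ_p)]`, Exercise
  6.3.10), Thm. 6.2.13. [Bellaiche2021]
* B. Perrin-Riou, Ann. Inst. Fourier 43 (1993) (leading terms and heights — context of (c) only). [PerrinRiou1993AIF]
-/

noncomputable section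

open Filter Topology Literature.NumberTheory.EllipticCurves

namespace Literature.NumberTheory.IwasawaTheory

/-! ### The algebra structure on ball values: convolution (the product of `Λ ⊂ 𝓗`), units, `p`-power shifts -/

section Algebra

variable (p : ℕ) [Fact p.Prime]

/-- **Convolution of ball values on `Γ`** — the product of the completed group ring
`Λ = lim_n R[Γ/Γ^{pⁿ}]` computed level by level: `(u ⋆ μ)(γ^s Γ^{pⁿ}) = ∑_{t mod pⁿ} u(γ^t Γ^{pⁿ}) μ(γ^{s−t} Γ^{pⁿ})`
(Bellaïche §6.3.5: *"Λ := ℤ_p[[ℤ_p^*]] := lim ℤ_p[ℤ_p^*/(1 + pⁿℤ_p)]"* — at level `n` the group-ring product; for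
distributions this is `∫∫ 1_{γ^sΓ^{pⁿ}}(xy) du(x) dμ(y)` since `y ↦ u(γ^sΓ^{pⁿ} y⁻¹)` is constant on level-`n` balls).
It extends the product of `𝓗 ⊃ Λ[1/p]` on tempered elements (Benois §1.6). [cite: Bellaiche2021, §6.3.5] [cite: Benois2014, §1.6] -/
def gammaConv (u μ : (n : ℕ) → ZMod (p ^ n) → ℂ_[p]) : (n : ℕ) → ZMod (p ^ n) → ℂ_[p] :=
  fun n s ↦ ∑ t : ZMod (p ^ n), u n t * μ n (s - t)

/-- **The Dirac mass at `1 ∈ Γ`** (the unit `[1]` of `Λ`): ball value `1` on the balls containing `1`, `0` elsewhere.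
[cite: Bellaiche2021, §6.3.5] -/
def gammaDirac : (n : ℕ) → ZMod (p ^ n) → ℂ_[p] :=
  fun _ s ↦ if s = 0 then 1 else 0

/-- **`Λ_𝓞`-integrality**: all ball values have norm `≤ 1` — the ball values of an element of
`𝓞[[Γ]] = lim 𝓞[Γ/Γ^{pⁿ}]` (Bellaïche §6.3.5; Exercise 6.3.10: *"an element f of 𝓞(𝓦) which satisfies |f(w)| ≤ 1
for every w … belongs to Λ"*).  Container: `𝓞 = 𝓞_{ℂ_p}` (print: `𝓞_E`). [cite: Bellaiche2021, §6.3.5 and Exercise 6.3.10] -/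
def IsIwasawaIntegral (u : (n : ℕ) → ZMod (p ^ n) → ℂ_[p]) : Prop :=
  ∀ (n : ℕ) (s : ZMod (p ^ n)), ‖u n s‖ ≤ 1

/-- **Units of the Iwasawa algebra**, `u ∈ Λ_𝓞^×`: an additive (`IsGammaDistribution`), integral system of ball
values whose total mass `u(Γ) = u 0 0` (the augmentation, i.e. the constant term under `Λ_𝓞 ≅ 𝓞[[T]]`,
`[γ] ↦ 1 + T`, Bellaïche §6.3.5) is a unit of `𝓞` — a power series over the local ring `𝓞` is invertible iff its
constant term is.  These are the "bounded with bounded inverse" factors of the request. [cite: Bellaiche2021, §6.3.5] [cite: Benois2014, §0.4 Remark 1] -/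
def IsIwasawaUnit (u : (n : ℕ) → ZMod (p ^ n) → ℂ_[p]) : Prop :=
  IsGammaDistribution p u ∧ IsIwasawaIntegral p u ∧ ‖u 0 0‖ = 1

/-- **`u ∈ p^ℤ · Λ_𝓞^×`** — the ambiguity group of a characteristic element: Benois §0.4 Remark 1 (*"Since
𝓗^* = Λ[1/p]^* … f_D [is determined] up to multiplication by a unit in Λ[1/p]"*), and `Λ[1/p]^× = p^ℤ · Λ^×`
(Weierstrass preparation).  TODO(general form): for a ramified coefficient field `E` the
printed group is `ϖ_E^ℤ · Λ^×`; the tree fixes integral powers of `p`. [cite: Benois2014, §0.4 Remark 1] -/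
def IsIwasawaUnitUpToPPower (u : (n : ℕ) → ZMod (p ^ n) → ℂ_[p]) : Prop :=
  ∃ (e : ℤ) (v : (n : ℕ) → ZMod (p ^ n) → ℂ_[p]),
    IsIwasawaUnit p v ∧ ∀ (n : ℕ) (s : ZMod (p ^ n)), u n s = (p : ℂ_[p]) ^ e * v n s

/-! ### The interface at the trivial character: order of vanishing and leading coefficient (DEFINED, not slots) -/

/-- **Order of vanishing at the trivial character**: the `T`-adic order of the Amice transform
`L_μ(T) = ∑_k c_k T^k` of the ball values (`gammaAmiceTransform`, variable `1 + T ↔ γ`, so `T = 0` is the trivial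
character `𝟙` of `Γ`); `⊤` iff `L_μ = 0`.  For an order-`< 1` additive `μ` the `c_k` are honest limits (D1,
`tendsto_gammaRiemannSum_gammaMahlerCoeff`). [cite: MazurTateTeitelbaum1986Invent, §I.13] [cite: Benois2014, §0.4 (L_p(M,D,s) = f_D(χ(γ₀)^s − 1))] -/
def gammaOrderAtOne (μ : (n : ℕ) → ZMod (p ^ n) → ℂ_[p]) : ℕ∞ :=
  (gammaAmiceTransform p μ).order

/-- **Leading coefficient at the trivial character**: the coefficient `c_r` of `T^r` in the Amice transform,
`r = gammaOrderAtOne` (junk `c_0 = 0` when the transform vanishes identically).  In the variable `s` of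
`f(χ(γ₀)^s − 1)` the leading coefficient is `(log_p χ(γ₀))^r · c_r` — consumers choose. [cite: MazurTateTeitelbaum1986Invent, §I.13] [cite: Benois2014, §0.4 (L_p(M,D,s) = f_D(χ(γ₀)^s − 1))] -/
def gammaLeadingCoeff (μ : (n : ℕ) → ZMod (p ^ n) → ℂ_[p]) : ℂ_[p] :=
  PowerSeries.coeff (gammaOrderAtOne p μ).toNat (gammaAmiceTransform p μ)

end Algebra

/-! ### The datum -/

section Datum

/-- **Hypothesis structure: the finite-slope cyclotomic Iwasawa module of the untwist and its characteristic
element** (definition request D3).  For the untwist datum `(W, η, α)` of D1 (phantom parameters tagging the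
intended instance: `V = V₃(f_W ⊗ η̄)`, `D_α` the rank-one `(φ,Γ)`-submodule of the `α`-triangulation, Pottharst's
strict ordinary local condition `RΓ(G, D_α) → RΓ(G, D†_rig V)` at `3`, unramified conditions away from `3`, the
cyclotomic Iwasawa Selmer complex over `𝓗`; Benois's `H²_Iw(V, D_α)`, *"a coadmissible torsion 𝓗-module"* with
*"char_𝓗(H²_Iw(V,D)) = (f_D)"* being the expected identity with the analytic side): the fields record (a) ONE generator `charElt` of
`char_𝓗 H²_Iw(V, D_α)` as additive ball values on `Γ = 1 + 3ℤ₃` of growth order `≤ ½ = v₃(α)` (normalisation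
caveat in the module docstring), (b) the declared `3`-power exponent `pPowerShift` of the chosen generator (the
`𝓗^× = 3^ℤ · Λ^×` ambiguity, Benois §0.4 Remark 1; *"direct access to no integral information"*, Pottharst
p. 1573) — a visible, unconstrained slot, and (c) the dimension `selmerRank` of the extended Selmer group
`H¹(V, D_α)` (Benois §4.1).  No axiom relates (b), (c) to (a): the control inequality, the exact order and the `(charElt) = (𝓛)`
 identity of ideals are the predicates below; the leading-term formula is absent.  The zero system is a datum (`zero`):
NO existence, torsion-ness or canonicity is asserted. [cite: Benois2014, §0.4 (ii) and Remark 1; §2.4 Remark 2; §4.1 Definition] [cite: Pottharst2013, §3B (p. 1603), Example 3.12, §3D (p. 1607), p. 1573] -/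
structure PSFiniteSlopeSelmerData (W : WeierstrassCurve ℚ) (η : DirichletCharacter ℂ_[3] (3 ^ 2))
    (α : ℂ_[3]) where
  /-- (a) A generator of `char_𝓗 H²_Iw(V, D_α)`, as ball values on `Γ = 1 + 3ℤ₃` (D1's indexing). -/
  charElt : (n : ℕ) → ZMod (3 ^ n) → ℂ_[3]
  /-- The generator is a distribution (additive ball values). -/
  isGammaDistribution_charElt : IsGammaDistribution 3 charElt
  /-- Normalisation: the generator is tempered of order `≤ ½ = v₃(α)` (so it is determined by its values at the
  finite-order characters of `Γ`, and its Mahler coefficients converge). -/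
  hasGrowthOrder_charElt : HasGrowthOrder 3 (1 / 2) charElt
  /-- (b) The DECLARED `3`-power exponent `e` of the chosen generator above an integral normalisation
  (`𝓗^× = 3^ℤ · Λ^×`); unconstrained here — see `IsNormalisedFor`, `normalisedCharElt`. -/
  pPowerShift : ℤ
  /-- (c) `dim_E H¹(V, D_α)`, the extended Selmer group at the base (Benois §4.1; intended: the Mordell–Weil rank of
  `W` when `Ш(W/ℚ)[3^∞]` is finite and no extra zero occurs); unconstrained here — see `HasControlInequality`. -/
  selmerRank : ℕ

end Datum

namespace PSFiniteSlopeSelmerData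

variable {W : WeierstrassCurve ℚ} {η : DirichletCharacter ℂ_[3] (3 ^ 2)} {α : ℂ_[3]}

/-- (c) The order of vanishing of the characteristic element at the trivial character (`T`-adic order of its
Amice transform). [cite: Benois2014, §0.4 (L_p(M,D,s) = f_D(χ(γ₀)^s − 1))] -/
def orderAtOne (D : PSFiniteSlopeSelmerData W η α) : ℕ∞ :=
  gammaOrderAtOne 3 D.charElt

/-- (c) The leading coefficient of the characteristic element at the trivial character (coefficient of
`T^{orderAtOne}` of its Amice transform) — the quantity the route's READ crux compares, after the shift by
`pPowerShift`, with `#Ш · ∏ c_ℓ · Reg_ψ / #E(ℚ)_tors²`; that comparison (Perrin-Riou) is NOT stated in this file.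
[cite: Benois2014, §4.2 (Definition of the height pairing; Prop. 12)] [cite: PerrinRiou1993AIF, Introduction] -/
def leadingCoeffAtOne (D : PSFiniteSlopeSelmerData W η α) : ℂ_[3] :=
  gammaLeadingCoeff 3 D.charElt

/-- (b) The consumer-normalised generator `3^{−e} · charElt`, `e = pPowerShift`. [cite: Benois2014, §0.4 Remark 1] -/
def normalisedCharElt (D : PSFiniteSlopeSelmerData W η α) : (n : ℕ) → ZMod (3 ^ n) → ℂ_[3] :=
  fun n s ↦ (3 : ℂ_[3]) ^ (-D.pPowerShift) * D.charElt n s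

/-- **The identity of ideals `(charElt) = (𝓛)` in `𝓗`, IMC₃'s shape** (Benois §0.4 (ii) read through Remark 1): the
chosen generator equals `u ⋆ 𝓛` for some `u ∈ 3^ℤ · Λ_𝓞^×`, where `𝓛` is (the ball values of) the analytic `3`-adic
`L`-function — the consumer supplies `IsPSCyclotomicLFunctionOf W η α 𝓛` (D1).  A PREDICATE on the datum (the
route's crux takes it as a hypothesis); nothing asserted. [cite: Benois2014, §0.4 (ii) and Remark 1] -/
def IsUnitMultipleOf (D : PSFiniteSlopeSelmerData W η α) (𝓛 : (n : ℕ) → ZMod (3 ^ n) → ℂ_[3]) : Prop :=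
  ∃ u : (n : ℕ) → ZMod (3 ^ n) → ℂ_[3], IsIwasawaUnitUpToPPower 3 u ∧ D.charElt = gammaConv 3 u 𝓛

/-- **`(charElt) = (𝓛)` at the finite-order characters** (the request's fallback form of IMC₃'s shape): `char(ξ) = u(ξ) · 𝓛(ξ)` for every
Dirichlet character `ξ` of `3`-power conductor (values `gammaCharValue`, D1), `u ∈ 3^ℤ · Λ_𝓞^×`.  For order-`< 1`
systems both sides are determined by these values (Bellaïche Thm. 6.2.13). [cite: Benois2014, §0.4 (ii) and Remark 1] [cite: Bellaiche2021, Thm. 6.2.13] -/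
def IsUnitMultipleOfAtCharacters (D : PSFiniteSlopeSelmerData W η α) (𝓛 : (n : ℕ) → ZMod (3 ^ n) → ℂ_[3]) : Prop :=
  ∃ u : (n : ℕ) → ZMod (3 ^ n) → ℂ_[3], IsIwasawaUnitUpToPPower 3 u ∧
    ∀ (m : ℕ) (ξ : DirichletCharacter ℂ_[3] (3 ^ m)),
      gammaCharValue 3 D.charElt ξ = gammaCharValue 3 u ξ * gammaCharValue 3 𝓛 ξ

/-- **(b) The normalisation predicate**: the declared exponent `e = pPowerShift` IS the `3`-power by which the
chosen generator differs from `v ⋆ 𝓛` with `v` a genuine unit of `Λ_𝓞` — i.e. `normalisedCharElt = v ⋆ 𝓛`.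
Implies `IsUnitMultipleOf`.  A PREDICATE (hypothesis shape); nothing asserted. [cite: Benois2014, §0.4 Remark 1 and Remark 2] -/
def IsNormalisedFor (D : PSFiniteSlopeSelmerData W η α) (𝓛 : (n : ℕ) → ZMod (3 ^ n) → ℂ_[3]) : Prop :=
  ∃ v : (n : ℕ) → ZMod (3 ^ n) → ℂ_[3], IsIwasawaUnit 3 v ∧
    ∀ (n : ℕ) (s : ZMod (3 ^ n)), D.charElt n s = (3 : ℂ_[3]) ^ D.pPowerShift * gammaConv 3 v 𝓛 n s

/-- **(c) The control inequality** as a predicate: the characteristic element vanishes at `𝟙` to order at least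
`dim_E H¹(V, D_α)` (the shape of Benois §4.2 Prop. 12 / Perrin-Riou's structure theorem; NOT asserted). [cite: Benois2014, §4.2 Prop. 12] -/
def HasControlInequality (D : PSFiniteSlopeSelmerData W η α) : Prop :=
  (D.selmerRank : ℕ∞) ≤ D.orderAtOne

/-- **(c) Exact order at `𝟙`** as a predicate: order of vanishing `=` `dim_E H¹(V, D_α)` (the expected consequence
of a non-degenerate height `⟨·,·⟩_{V,D_α}`, Benois §4.2; NOT asserted). [cite: Benois2014, §4.2 (Definition; Prop. 12)] -/
def HasExactOrderAtOne (D : PSFiniteSlopeSelmerData W η α) : Prop :=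
  D.orderAtOne = D.selmerRank

end PSFiniteSlopeSelmerData

/-! ### API -/

section API

variable {p : ℕ} [Fact p.Prime]

/-- Unfolding lemma (definitional). [cite: Bellaiche2021, §6.3.5] -/
theorem gammaConv_apply (u μ : (n : ℕ) → ZMod (p ^ n) → ℂ_[p]) (n : ℕ) (s : ZMod (p ^ n)) :
    gammaConv p u μ n s = ∑ t : ZMod (p ^ n), u n t * μ n (s - t) :=
  rfl

/-- Unfolding lemma (definitional). [cite: Bellaiche2021, §6.3.5] -/
theorem gammaDirac_apply (n : ℕ) (s : ZMod (p ^ n)) :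
    gammaDirac p n s = if s = 0 then 1 else 0 :=
  rfl

/-- `[1] ⋆ μ = μ`: the Dirac mass at `1` is a left unit for convolution. [cite: Bellaiche2021, §6.3.5] -/
theorem gammaConv_gammaDirac_left (μ : (n : ℕ) → ZMod (p ^ n) → ℂ_[p]) :
    gammaConv p (gammaDirac p) μ = μ := by
  funext n s
  simp [gammaConv, gammaDirac]

/-- `μ ⋆ [1] = μ`: the Dirac mass at `1` is a right unit for convolution. [cite: Bellaiche2021, §6.3.5] -/
theorem gammaConv_gammaDirac_right (μ : (n : ℕ) → ZMod (p ^ n) → ℂ_[p]) :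
    gammaConv p μ (gammaDirac p) = μ := by
  funext n s
  simp [gammaConv, gammaDirac, sub_eq_zero]

/-- Convolution is additive in the left factor. [cite: Bellaiche2021, §6.3.5] -/
theorem gammaConv_add_left (u u' μ : (n : ℕ) → ZMod (p ^ n) → ℂ_[p]) :
    gammaConv p (fun n s ↦ u n s + u' n s) μ =
      fun n s ↦ gammaConv p u μ n s + gammaConv p u' μ n s := by
  funext n s
  simp only [gammaConv, add_mul, Finset.sum_add_distrib]

/-- Convolution commutes with scalars in the left factor. [cite: Bellaiche2021, §6.3.5] -/
theorem gammaConv_smul_left (c : ℂ_[p]) (u μ : (n : ℕ) → ZMod (p ^ n) → ℂ_[p]) :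
    gammaConv p (fun n s ↦ c * u n s) μ = fun n s ↦ c * gammaConv p u μ n s := by
  funext n s
  simp only [gammaConv, Finset.mul_sum, mul_assoc]

/-- Convolution is commutative (reindex `t ↦ s − t`). [cite: Bellaiche2021, §6.3.5] -/
theorem gammaConv_comm (u μ : (n : ℕ) → ZMod (p ^ n) → ℂ_[p]) :
    gammaConv p u μ = gammaConv p μ u := by
  funext n s
  simp only [gammaConv]
  rw [← Equiv.sum_comp (Equiv.subLeft s)]
  refine Finset.sum_congr rfl fun t _ ↦ ?_
  simp [Equiv.subLeft_apply, sub_sub_cancel, mul_comm]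

/-- Unfolding lemma (definitional). [cite: Bellaiche2021, §6.3.5 and Exercise 6.3.10] -/
theorem isIwasawaIntegral_iff (u : (n : ℕ) → ZMod (p ^ n) → ℂ_[p]) :
    IsIwasawaIntegral p u ↔ ∀ (n : ℕ) (s : ZMod (p ^ n)), ‖u n s‖ ≤ 1 :=
  Iff.rfl

/-- Unfolding lemma (definitional). [cite: Bellaiche2021, §6.3.5] -/
theorem isIwasawaUnit_iff (u : (n : ℕ) → ZMod (p ^ n) → ℂ_[p]) :
    IsIwasawaUnit p u ↔ IsGammaDistribution p u ∧ IsIwasawaIntegral p u ∧ ‖u 0 0‖ = 1 :=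
  Iff.rfl

/-- An integral system has growth of order `≤ 0` (it is a measure: bounded ball values). [cite: Bellaiche2021, Def. 6.2.10 and §6.3.5] -/
theorem IsIwasawaIntegral.hasGrowthOrder_zero {u : (n : ℕ) → ZMod (p ^ n) → ℂ_[p]}
    (hu : IsIwasawaIntegral p u) : HasGrowthOrder p 0 u :=
  ⟨1, fun n s ↦ by simpa using hu n s⟩

/-- The Dirac mass at `1` is additive: exactly one sub-ball of the ball containing `1` contains `1`.
[cite: Bellaiche2021, §6.3.5] -/
theorem isGammaDistribution_gammaDirac : IsGammaDistribution p (gammaDirac p) := by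
  intro n s
  simp only [gammaDirac]
  rw [Finset.sum_ite_eq' (Finset.univ.filter _) (0 : ZMod (p ^ (n + 1))) (fun _ ↦ (1 : ℂ_[p]))]
  simp only [Finset.mem_filter, Finset.mem_univ, true_and, map_zero]
  by_cases hs : s = 0
  · simp [hs]
  · simp [hs, Ne.symm hs]

/-- The Dirac mass at `1` is a unit of `Λ_𝓞` (it is `[1] = 1`). [cite: Bellaiche2021, §6.3.5] -/
theorem isIwasawaUnit_gammaDirac : IsIwasawaUnit p (gammaDirac p) := by
  refine ⟨isGammaDistribution_gammaDirac, fun n s ↦ ?_, by simp [gammaDirac]⟩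
  by_cases hs : s = 0 <;> simp [gammaDirac, hs]

/-- A unit of `Λ_𝓞` lies in `p^ℤ · Λ_𝓞^×` (exponent `0`). [cite: Benois2014, §0.4 Remark 1] -/
theorem IsIwasawaUnit.isIwasawaUnitUpToPPower {u : (n : ℕ) → ZMod (p ^ n) → ℂ_[p]}
    (hu : IsIwasawaUnit p u) : IsIwasawaUnitUpToPPower p u :=
  ⟨0, u, hu, fun n s ↦ by simp⟩

/-- `p^e · v` lies in `p^ℤ · Λ_𝓞^×` for a unit `v`. [cite: Benois2014, §0.4 Remark 1] -/
theorem IsIwasawaUnit.isIwasawaUnitUpToPPower_zpow_mul {v : (n : ℕ) → ZMod (p ^ n) → ℂ_[p]}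
    (hv : IsIwasawaUnit p v) (e : ℤ) :
    IsIwasawaUnitUpToPPower p (fun n s ↦ (p : ℂ_[p]) ^ e * v n s) :=
  ⟨e, v, hv, fun _ _ ↦ rfl⟩

/-- Unfolding lemma (definitional). [cite: Benois2014, §0.4 (L_p(M,D,s) = f_D(χ(γ₀)^s − 1))] -/
theorem gammaOrderAtOne_def (μ : (n : ℕ) → ZMod (p ^ n) → ℂ_[p]) :
    gammaOrderAtOne p μ = (gammaAmiceTransform p μ).order :=
  rfl

/-- Unfolding lemma (definitional). [cite: Benois2014, §0.4 (L_p(M,D,s) = f_D(χ(γ₀)^s − 1))] -/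
theorem gammaLeadingCoeff_def (μ : (n : ℕ) → ZMod (p ^ n) → ℂ_[p]) :
    gammaLeadingCoeff p μ = PowerSeries.coeff (gammaOrderAtOne p μ).toNat (gammaAmiceTransform p μ) :=
  rfl

/-- The order at `𝟙` is `⊤` iff the Amice transform vanishes identically. [cite: MazurTateTeitelbaum1986Invent, §I.13] -/
theorem gammaOrderAtOne_eq_top_iff (μ : (n : ℕ) → ZMod (p ^ n) → ℂ_[p]) :
    gammaOrderAtOne p μ = ⊤ ↔ gammaAmiceTransform p μ = 0 :=
  PowerSeries.order_eq_top

/-- If the Amice transform is non-zero, the leading coefficient is non-zero. [cite: MazurTateTeitelbaum1986Invent, §I.13] -/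
theorem gammaLeadingCoeff_ne_zero {μ : (n : ℕ) → ZMod (p ^ n) → ℂ_[p]} (h : gammaAmiceTransform p μ ≠ 0) :
    gammaLeadingCoeff p μ ≠ 0 :=
  PowerSeries.coeff_order h

/-- If the characteristic element does not vanish at `𝟙` (`c_0 = μ(Γ) ≠ 0`), the order at `𝟙` is `0`.
[cite: MazurTateTeitelbaum1986Invent, §I.13] -/
theorem gammaOrderAtOne_eq_zero_of_coeff_zero_ne_zero {μ : (n : ℕ) → ZMod (p ^ n) → ℂ_[p]}
    (h : gammaMahlerCoeff p μ 0 ≠ 0) : gammaOrderAtOne p μ = 0 := by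
  rw [gammaOrderAtOne_def, ← Nat.cast_zero, PowerSeries.order_eq_nat]
  refine ⟨by simpa using h, fun i hi ↦ ?_⟩
  exact absurd hi (Nat.not_lt_zero i)

/-- The Riemann sums of the zero system vanish. [cite: MazurTateTeitelbaum1986Invent, §I.13] -/
theorem gammaRiemannSum_zero_system (φ : ℕ → ℂ_[p]) (n : ℕ) :
    gammaRiemannSum p (fun _ _ ↦ (0 : ℂ_[p])) φ n = 0 := by
  simp [gammaRiemannSum_def]

/-- The Amice transform of the zero system is zero (its Mahler coefficients are limits of zero Riemann sums).
[cite: MazurTateTeitelbaum1986Invent, §I.13] -/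
theorem gammaAmiceTransform_zero_system : gammaAmiceTransform p (fun _ _ ↦ (0 : ℂ_[p])) = 0 := by
  ext k
  rw [coeff_gammaAmiceTransform, map_zero, gammaMahlerCoeff, gammaIntegral]
  have h : gammaRiemannSum p (fun _ _ ↦ (0 : ℂ_[p])) (fun a ↦ ((a.choose k : ℕ) : ℂ_[p])) = fun _ ↦ 0 := by
    funext n
    exact gammaRiemannSum_zero_system _ n
  rw [h]
  exact tendsto_const_nhds.limUnder_eq

/-- The zero system vanishes at `𝟙` to infinite order. [cite: MazurTateTeitelbaum1986Invent, §I.13] -/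
theorem gammaOrderAtOne_zero_system : gammaOrderAtOne p (fun _ _ ↦ (0 : ℂ_[p])) = ⊤ :=
  (gammaOrderAtOne_eq_top_iff _).mpr gammaAmiceTransform_zero_system

end API

namespace PSFiniteSlopeSelmerData

variable {W : WeierstrassCurve ℚ} {η : DirichletCharacter ℂ_[3] (3 ^ 2)} {α : ℂ_[3]}
  (D : PSFiniteSlopeSelmerData W η α)

/-- Unfolding lemma (definitional). [cite: Benois2014, §0.4 (L_p(M,D,s) = f_D(χ(γ₀)^s − 1))] -/
theorem orderAtOne_def : D.orderAtOne = (gammaAmiceTransform 3 D.charElt).order :=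
  rfl

/-- Unfolding lemma (definitional). [cite: Benois2014, §0.4 (L_p(M,D,s) = f_D(χ(γ₀)^s − 1))] -/
theorem leadingCoeffAtOne_def :
    D.leadingCoeffAtOne = PowerSeries.coeff D.orderAtOne.toNat (gammaAmiceTransform 3 D.charElt) :=
  rfl

/-- Unfolding lemma (definitional). [cite: Benois2014, §0.4 Remark 1] -/
theorem normalisedCharElt_apply (n : ℕ) (s : ZMod (3 ^ n)) :
    D.normalisedCharElt n s = (3 : ℂ_[3]) ^ (-D.pPowerShift) * D.charElt n s :=
  rfl

/-- Unfolding lemma (definitional). [cite: Benois2014, §0.4 (ii) and Remark 1] -/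
theorem isUnitMultipleOf_iff (𝓛 : (n : ℕ) → ZMod (3 ^ n) → ℂ_[3]) :
    D.IsUnitMultipleOf 𝓛 ↔
      ∃ u : (n : ℕ) → ZMod (3 ^ n) → ℂ_[3], IsIwasawaUnitUpToPPower 3 u ∧ D.charElt = gammaConv 3 u 𝓛 :=
  Iff.rfl

/-- Unfolding lemma (definitional). [cite: Benois2014, §4.2 Prop. 12] -/
theorem hasControlInequality_iff : D.HasControlInequality ↔ (D.selmerRank : ℕ∞) ≤ D.orderAtOne :=
  Iff.rfl

/-- Unfolding lemma (definitional). [cite: Benois2014, §4.2 (Definition; Prop. 12)] -/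
theorem hasExactOrderAtOne_iff : D.HasExactOrderAtOne ↔ D.orderAtOne = D.selmerRank :=
  Iff.rfl

/-- The normalised generator is the generator rescaled: `3^e · normalisedCharElt = charElt`.
[cite: Benois2014, §0.4 Remark 1] -/
theorem zpow_mul_normalisedCharElt (n : ℕ) (s : ZMod (3 ^ n)) :
    (3 : ℂ_[3]) ^ D.pPowerShift * D.normalisedCharElt n s = D.charElt n s := by
  rw [normalisedCharElt_apply, ← mul_assoc, ← zpow_add₀ (by norm_num : (3 : ℂ_[3]) ≠ 0), add_neg_cancel,
    zpow_zero, one_mul]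

/-- The normalised generator is again additive of order `≤ ½`. [cite: Benois2014, §0.4 Remark 1] -/
theorem isGammaDistribution_and_hasGrowthOrder_normalisedCharElt :
    IsGammaDistribution 3 D.normalisedCharElt ∧ HasGrowthOrder 3 (1 / 2) D.normalisedCharElt :=
  ⟨D.isGammaDistribution_charElt.smul _, D.hasGrowthOrder_charElt.smul _⟩

/-- **The normalisation predicate implies the identity-of-ideals shape** (with `u = 3^e · v`).
[cite: Benois2014, §0.4 (ii) and Remark 1] -/
theorem IsNormalisedFor.isUnitMultipleOf {𝓛 : (n : ℕ) → ZMod (3 ^ n) → ℂ_[3]}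
    (h : D.IsNormalisedFor 𝓛) : D.IsUnitMultipleOf 𝓛 := by
  obtain ⟨v, hv, hchar⟩ := h
  refine ⟨fun n s ↦ (3 : ℂ_[3]) ^ D.pPowerShift * v n s, ?_, ?_⟩
  · have h3 := hv.isIwasawaUnitUpToPPower_zpow_mul D.pPowerShift
    simpa using h3
  · funext n s
    rw [hchar n s]
    have := congrFun (congrFun (gammaConv_smul_left (p := 3) ((3 : ℂ_[3]) ^ D.pPowerShift) v 𝓛) n) s
    simpa using this.symm

/-- An exact order at `𝟙` gives the control inequality. [cite: Benois2014, §4.2 Prop. 12] -/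
theorem HasExactOrderAtOne.hasControlInequality (h : D.HasExactOrderAtOne) : D.HasControlInequality := by
  rw [hasControlInequality_iff, h]

variable (W η α) in
/-- **Vacuity flag.** The zero system (with declared exponent `0` and rank `0`) is a datum: torsion-ness of
`H²_Iw(V, D_α)` (i.e. `charElt ≠ 0`), the identity `(charElt) = (𝓛)` and the normalisation are NOT axiomatised, so
`PSFiniteSlopeSelmerData W η α` must not be read as an existence statement; consumers quantify over the datum.
[cite: Benois2014, §0.4 (ii); §4.2 Prop. 12] -/
def zero : PSFiniteSlopeSelmerData W η α where
  charElt := fun _ _ ↦ 0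
  isGammaDistribution_charElt := isGammaDistribution_zero
  hasGrowthOrder_charElt := hasGrowthOrder_zero (1 / 2)
  pPowerShift := 0
  selmerRank := 0

/-- The zero datum has all ball values zero (unfolding of the vacuity flag). [cite: Benois2014, §0.4 (ii)] -/
@[simp] theorem zero_charElt (n : ℕ) (s : ZMod (3 ^ n)) : (zero W η α).charElt n s = 0 :=
  rfl

/-- The zero datum vanishes at `𝟙` to infinite order — junk detectably violating torsion-ness, and satisfying
the control inequality vacuously. [cite: Benois2014, §0.4 (ii); §4.2 Prop. 12] -/
theorem zero_orderAtOne : (zero W η α).orderAtOne = ⊤ :=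
  gammaOrderAtOne_zero_system

/-- The zero datum satisfies the control inequality (vacuity of that predicate on junk). [cite: Benois2014, §4.2 Prop. 12] -/
theorem zero_hasControlInequality : (zero W η α).HasControlInequality := by
  rw [hasControlInequality_iff, zero_orderAtOne]
  exact le_top

end PSFiniteSlopeSelmerData

end Literature.NumberTheory.IwasawaTheory

end
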